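import Literature.Geometry.Riemannian.BaerHankeNormalForm
import Literature.Geometry.Riemannian.BaerHankeNormalFormCore
import Literature.Geometry.Riemannian.BoundaryCylinderSliceData
import Literature.Geometry.Riemannian.BoundaryCylinderMetric
import Literature.Geometry.Lorentzian.LocalIsometryScalarCurvature
import Literature.Geometry.Manifold.SmoothEmbeddingInverse
import Literature.Topology.FourManifolds.CollarCriterion
import Literature.Topology.FourManifolds.CollarTheorem
import Literature.Topology.FourManifolds.GluingProofs
import Mathlib.Geometry.Manifold.Instances.Icc
import HarnessLib

/-!
# Bär–Hanke, Thm. 27 (umbilic `C`-normal form): reduction to the deformation of the boundary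
# cylinder

Topic `Literature/Geometry/Riemannian` (namespace `Literature.Geometry.Riemannian`). Proof file
(sibling of `BaerHankeNormalForm.lean`) for the named fact
`Literature.Geometry.Riemannian.BarHanke2023_thm27_umbilicNormalForm` — Bär–Hanke 2023, §3,
**Thm. 27** (master deformation theorem) read through **Def. 21** (`C`-normal metrics), point
family, `σ = 0`, umbilic `k = μ g₀`, end point `f(1)` only.

**The printed proof** (arXiv:2012.09127, pp. 10–13) has two analytic steps, both carried out
on the collar `[0, ε) × ∂M` in which `g = dt² + g_t` ((7)–(8), generalized Gauss lemma) and
`scal_g` is given by the generalized-cylinder formula (9):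
Prop. 23 (make `g` `C`-normal keeping `g|∂M`, `II_g` and `scal > σ`; globalised by the local
flexibility lemma of [BarHanke2021], whose cut-offs are `LogarithmicCutoff.lean`) and Prop. 26
(change the second fundamental form of a `C`-normal metric from `h` to `k` when
`tr h ≥ tr k`, with the cut-offs of Lemma 25, `BaerHankeCutoff.lean`, and the trace comparison
Lemma 24, `BaerHankeTraceComparison.lean`); Thm. 27 is Prop. 23 followed by Prop. 26 with
`h = II_g`. Everything else is bookkeeping: the collar is the normal exponential map, the
deformed metric coincides with `g` away from the collar, and a `C`-normal metric with
`II = μ g₀` is `dt² + (1 - 2μt - Ct²) g₀` near the boundary (Def. 21, Remark 22).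

**This file proves the bookkeeping** and thereby REDUCES the named fact to its analytic core,
stated on the boundary cylinder of the tree's proof programme of
`Literature.Geometry.Riemannian.BaerHankePscGluing` (`BoundaryCylinderMetric.lean`: the metric
of the piece near `∂X` is a Riemannian generalized cylinder `G` on `∂X × ℝ`, `G = E^*ĝ_P` on the
Fermi tube, `E` the normal geodesics of an extension `ĝ_P` of `g` to the double `P ⊃ X`):

* `BarHanke2023_thm27_umbilicNormalForm_of_cylinderDeformation` — **the reduction**: the named
  fact follows from the hypothesis `hcore` = Prop. 23 + Prop. 26 (end points, point family) for
  cylinder metrics: *for a Riemannian cylinder metric `G` on `N × ℝ` (`N` compact) with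
  `scal_G > 0` on `N × [0, ε]` and a smooth `μ` with `H^G_0 + (m+1) μ ≤ 0` (slice-`0` mean
  curvature w.r.t. `∂_t`; `= (m+1)μ ≤ H_g` in the tree's outward convention,
  `boundaryCylinder_sliceZero_meanCurvature`) there is `C₀ > 0` such that for every `C ≥ C₀`
  some Riemannian cylinder metric `G'` agrees with `G` for `t > ρ₁`, has `scal_{G'} > 0` on
  `N × [0, ρ]` (`0 < ρ₁ < ρ < ε`) and `G'_t = (1 - 2μt - Ct²) G_0` on `[0, ρ₀]`.* The proof of
  `hcore` (Props. 23, 26 on the cylinder, formula (9) = `cyl_scalarCurvature_eq`) is the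
  remaining work of this fact's programme; no named fact is introduced for it (D-0026).

The bookkeeping, all PROVED here (no definitions, no named facts):

* `exists_metric_patch` — patching a metric: `s` on an open `U`, `g` off a closed `K ⊆ U`,
  when `s` is a smooth symmetric positive section on `U` equal to `g` on `U \ K`;
* `contMDiffAt_fermi_comp`, `injective_mfderiv_fermi_comp`, `pullback_fermi_eq_of_eq`,
  `pullback_fermi_incl` — the Fermi map `Φ = ψ ∘ jM : X ⊇ tube → ∂X × ℝ` is a local
  diffeomorphism, `Φ^*G = g` (so `Φ^*G' = g` where `G' = G`), and `Φ ∘ incl` is the zero slice;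
* `exists_deformedMetric` — the metric `ĝ = Φ^*G'` on `{t < ρ}`, `= g` beyond: Riemannian, with
  Levi-Civita connection, `scal > 0` EVERYWHERE (naturality of the scalar curvature along `Φ`
  on the tube and along `jM` off it, boundary points included:
  `scalarCurvature_eq_of_val_eq_pullbackBilin`), and `incl^*ĝ = incl^*g`;
* `mfderiv_subtype_val_Icc`, `mfderiv_collarScale`, `collar_pullback_eq` — the differential of
  `[0,1] ⊆ ℝ` in Mathlib's charts of `Set.Icc` (`= ± V₀`; the chart at the top reverses the
  orientation), and the formula `(c^*ĝ)(V, W) = εc² V.2₀ W.2₀ + G'_{(z, εc s)}((V.1,0),(W.1,0))`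
  for the geodesic collar `c(z, s) = jM⁻¹(E(z, εc s))`;
* `exists_collar_of_fermiData` — the geodesic collar IS a `BoundaryData.Collar`
  (`OpenCollarData.toCollar` of `CollarCriterion.lean`: the Fermi chart supplies the smooth
  inverse `(proj, height)`).

## References

* [BarHanke2023] C. Bär, B. Hanke, *Boundary conditions for scalar curvature*, in *Perspectives
  in scalar curvature*, Vol. 2, World Sci. 2023, 325–377 = arXiv:2012.09127, §3: (7)–(9),
  Def. 21, Remark 22, Prop. 23, Lemma 24, Lemma 25, Prop. 26, Thm. 27 (pp. 10–13 of the arXiv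
  version, READ).
* [BarHanke2021] C. Bär, B. Hanke, *Local flexibility for open partial differential relations*,
  Comm. Pure Appl. Math. 75 (2022), Thm. 1, Addendum 19, Lemma 10.
* [LeeRiemannianManifolds2018] J. M. Lee, *Introduction to Riemannian Manifolds*, 2nd ed. (2018),
  Thm. 5.25, Example 6.44 (boundary normal coordinates).
-/

noncomputable section

open Bundle Set Function Filter
open scoped Manifold ContDiff Topology

namespace Literature.Geometry.Riemannian

open Literature.Geometry.Lorentzian Literature.Geometry.Lorentzian.PseudoRiemannianMetric
  Literature.Geometry.Manifold Literature.Topology.FourManifolds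

variable {m : ℕ} {X : Type} [TopologicalSpace X] [ChartedSpace (EuclideanHalfSpace (m + 2)) X]
  [IsManifold (𝓡∂ (m + 2)) ∞ X]
  {P : Type} [TopologicalSpace P] [ChartedSpace (EuclideanSpace ℝ (Fin (m + 2))) P]
  [IsManifold (𝓡 (m + 2)) ∞ P]
  {bX : BoundaryData (𝓡∂ (m + 2)) X (𝓡 (m + 1))}

/-- Transport of a metric value along an equality of base points (the tangent spaces of the
cylinder are the constant model space). [folklore] -/
theorem val_apply_congr_point {E' : Type*} [NormedAddCommGroup E'] [NormedSpace ℝ E']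
    {H' : Type*} [TopologicalSpace H'] {I' : ModelWithCorners ℝ E' H'} {N : Type*}
    [TopologicalSpace N] [ChartedSpace H' N] [IsManifold I' ∞ N] {n : ℕ∞ω}
    (G : PseudoRiemannianMetric I' n E' (TangentSpace I' : N → Type _)) {p q : N} (h : p = q)
    (v w : E') : G.val p v w = G.val q v w := by
  subst h
  rfl


omit [IsManifold (𝓡∂ (m + 2)) ∞ X] [IsManifold (𝓡 (m + 2)) ∞ P] in
/-- The Fermi chart composed with the piece embedding, `Φ = ψ ∘ jM`, is `C^∞` at every point
of the tube. [folklore] -/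
theorem contMDiffAt_fermi_comp {jM : X → P}
    (hjM : Manifold.IsSmoothEmbedding (𝓡∂ (m + 2)) (𝓡 (m + 2)) ∞ jM)
    (ψ : OpenPartialHomeomorph P (bX.carrier × ℝ))
    (hψs : ContMDiffOn (𝓡 (m + 2)) ((𝓡 (m + 1)).prod 𝓘(ℝ, ℝ)) ∞ ψ ψ.source)
    {x : X} (hx : jM x ∈ ψ.source) :
    ContMDiffAt (𝓡∂ (m + 2)) ((𝓡 (m + 1)).prod 𝓘(ℝ, ℝ)) ∞ (ψ ∘ jM) x :=
  ((hψs _ hx).contMDiffAt (ψ.open_source.mem_nhds hx)).comp x (hjM.contMDiff x)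

omit [IsManifold (𝓡∂ (m + 2)) ∞ X] [IsManifold (𝓡 (m + 2)) ∞ P] in
/-- `Φ = ψ ∘ jM` has injective differential on the tube (`jM` is an immersion and `ψ` is
inverted by the normal geodesics `T` near `jM x`). [folklore] -/
theorem injective_mfderiv_fermi_comp {jM : X → P}
    (hjM : Manifold.IsSmoothEmbedding (𝓡∂ (m + 2)) (𝓡 (m + 2)) ∞ jM)
    (T : bX.carrier × ℝ → P) (ψ : OpenPartialHomeomorph P (bX.carrier × ℝ)) {ε : ℝ}
    (hTs : ∀ q : bX.carrier × ℝ, q.2 ∈ Ioo (-ε) ε →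
      ContMDiffAt ((𝓡 (m + 1)).prod 𝓘(ℝ, ℝ)) (𝓡 (m + 2)) ∞ T q)
    (htgt : ψ.target = (univ : Set bX.carrier) ×ˢ Ioo (-ε) ε)
    (hsymm : ∀ q, ψ.symm q = T q)
    (hψs : ContMDiffOn (𝓡 (m + 2)) ((𝓡 (m + 1)).prod 𝓘(ℝ, ℝ)) ∞ ψ ψ.source)
    {x : X} (hx : jM x ∈ ψ.source) :
    Injective (mfderiv (𝓡∂ (m + 2)) ((𝓡 (m + 1)).prod 𝓘(ℝ, ℝ)) (ψ ∘ jM) x) := by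
  have hψd : MDifferentiableAt (𝓡 (m + 2)) ((𝓡 (m + 1)).prod 𝓘(ℝ, ℝ)) ψ (jM x) :=
    ((hψs _ hx).contMDiffAt (ψ.open_source.mem_nhds hx)).mdifferentiableAt (by simp)
  have hjd : MDifferentiableAt (𝓡∂ (m + 2)) (𝓡 (m + 2)) jM x :=
    (hjM.contMDiff x).mdifferentiableAt (by simp)
  have hq : (ψ (jM x)).2 ∈ Ioo (-ε) ε := by
    have h := ψ.map_source hx
    rw [htgt] at h
    exact h.2
  have hTd : MDifferentiableAt ((𝓡 (m + 1)).prod 𝓘(ℝ, ℝ)) (𝓡 (m + 2)) T (ψ (jM x)) :=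
    (hTs _ hq).mdifferentiableAt (by simp)
  -- `T ∘ ψ = id` near `jM x`
  have hid : ∀ᶠ p in 𝓝 (jM x), (T ∘ ψ) p = id p := by
    filter_upwards [ψ.open_source.mem_nhds hx] with p hp
    show T (ψ p) = p
    rw [← hsymm]
    exact ψ.left_inv hp
  have hcomp : mfderiv (𝓡 (m + 2)) (𝓡 (m + 2)) (T ∘ ψ) (jM x) =
      (mfderiv ((𝓡 (m + 1)).prod 𝓘(ℝ, ℝ)) (𝓡 (m + 2)) T (ψ (jM x))).comp (mfderiv (𝓡 (m + 2)) ((𝓡 (m + 1)).prod 𝓘(ℝ, ℝ)) ψ (jM x)) :=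
    mfderiv_comp (jM x) hTd hψd
  have hid' : mfderiv (𝓡 (m + 2)) (𝓡 (m + 2)) (T ∘ ψ) (jM x) = ContinuousLinearMap.id ℝ _ := by
    rw [Filter.EventuallyEq.mfderiv_eq hid, mfderiv_id]
  have hψinj : Injective (mfderiv (𝓡 (m + 2)) ((𝓡 (m + 1)).prod 𝓘(ℝ, ℝ)) ψ (jM x)) := by
    intro v w hvw
    have h := congrArg (mfderiv ((𝓡 (m + 1)).prod 𝓘(ℝ, ℝ)) (𝓡 (m + 2)) T (ψ (jM x))) hvw
    rw [← ContinuousLinearMap.comp_apply, ← ContinuousLinearMap.comp_apply, ← hcomp, hid'] at h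
    exact h
  rw [mfderiv_comp x hψd hjd]
  exact hψinj.comp (injective_mfderiv_of_isImmersionAt' (hjM.isImmersion.isImmersionAt x))

/-- **Beyond the deformation the pulled-back metric is the original one.** If the deformed
cylinder metric `G'` agrees with the boundary cylinder `G = T^* ĝ_P` at `ψ (jM x)`, then
`(ψ ∘ jM)^* G' = g` at `x` (`T ∘ ψ = id` near `jM x`, `jM^* ĝ_P = g`). [folklore] -/
theorem pullback_fermi_eq_of_eq {jM : X → P}
    (hjM : Manifold.IsSmoothEmbedding (𝓡∂ (m + 2)) (𝓡 (m + 2)) ∞ jM)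
    (g : PseudoRiemannianMetric (𝓡∂ (m + 2)) ∞ (EuclideanSpace ℝ (Fin (m + 2)))
      (TangentSpace (𝓡∂ (m + 2)) : X → Type _))
    (gP : PseudoRiemannianMetric (𝓡 (m + 2)) ∞ (EuclideanSpace ℝ (Fin (m + 2)))
      (TangentSpace (𝓡 (m + 2)) : P → Type _))
    (hpull : ∀ (a : X) (v w : TangentSpace (𝓡∂ (m + 2)) a),
      gP.val (jM a) (mfderiv (𝓡∂ (m + 2)) (𝓡 (m + 2)) jM a v)
        (mfderiv (𝓡∂ (m + 2)) (𝓡 (m + 2)) jM a w) = g.val a v w)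
    (T : bX.carrier × ℝ → P) (ψ : OpenPartialHomeomorph P (bX.carrier × ℝ)) {ε : ℝ}
    (hTs : ∀ q : bX.carrier × ℝ, q.2 ∈ Ioo (-ε) ε →
      ContMDiffAt ((𝓡 (m + 1)).prod 𝓘(ℝ, ℝ)) (𝓡 (m + 2)) ∞ T q)
    (htgt : ψ.target = (univ : Set bX.carrier) ×ˢ Ioo (-ε) ε)
    (hsymm : ∀ q, ψ.symm q = T q)
    (hψs : ContMDiffOn (𝓡 (m + 2)) ((𝓡 (m + 1)).prod 𝓘(ℝ, ℝ)) ∞ ψ ψ.source)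
    (G G' : PseudoRiemannianMetric ((𝓡 (m + 1)).prod 𝓘(ℝ, ℝ)) ∞
      (EuclideanSpace ℝ (Fin (m + 1)) × ℝ)
      (TangentSpace ((𝓡 (m + 1)).prod 𝓘(ℝ, ℝ)) : bX.carrier × ℝ → Type _))
    (hGval : ∀ (z : bX.carrier), ∀ t ∈ Ioo (-ε) ε,
      G.val (z, t) = pullbackBilin (I := 𝓡 (m + 2)) (I' := (𝓡 (m + 1)).prod 𝓘(ℝ, ℝ)) T
        gP.val (z, t))
    {x : X} (hx : jM x ∈ ψ.source) (hG'G : G'.val (ψ (jM x)) = G.val (ψ (jM x))) :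
    pullbackBilin (I := (𝓡 (m + 1)).prod 𝓘(ℝ, ℝ)) (I' := 𝓡∂ (m + 2)) (ψ ∘ jM) G'.val x =
      g.val x := by
  have hq : (ψ (jM x)).2 ∈ Ioo (-ε) ε := by
    have h := ψ.map_source hx
    rw [htgt] at h
    exact h.2
  have hΦd : MDifferentiableAt (𝓡∂ (m + 2)) ((𝓡 (m + 1)).prod 𝓘(ℝ, ℝ)) (ψ ∘ jM) x :=
    (contMDiffAt_fermi_comp hjM ψ hψs hx).mdifferentiableAt (by simp)
  have hTd : MDifferentiableAt ((𝓡 (m + 1)).prod 𝓘(ℝ, ℝ)) (𝓡 (m + 2)) T ((ψ ∘ jM) x) :=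
    (hTs _ hq).mdifferentiableAt (by simp)
  -- `T ∘ Φ = jM` near `x`
  have hev : (T ∘ (ψ ∘ jM)) =ᶠ[𝓝 x] jM := by
    have hopen : IsOpen (jM ⁻¹' ψ.source) := ψ.open_source.preimage hjM.isEmbedding.continuous
    filter_upwards [hopen.mem_nhds hx] with y hy
    show T (ψ (jM y)) = jM y
    rw [← hsymm]
    exact ψ.left_inv hy
  have hpt : (T ∘ (ψ ∘ jM)) x = jM x := hev.eq_of_nhds
  have hGx : G.val (ψ (jM x)) = pullbackBilin (I := 𝓡 (m + 2)) (I' := ((𝓡 (m + 1)).prod 𝓘(ℝ, ℝ))) T gP.val (ψ (jM x)) := by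
    have h := hGval (ψ (jM x)).1 (ψ (jM x)).2 hq
    rwa [Prod.mk.eta] at h
  refine ContinuousLinearMap.ext fun v ↦ ContinuousLinearMap.ext fun w ↦ ?_
  rw [pullbackBilin_apply]
  show G'.val (ψ (jM x)) _ _ = _
  rw [hG'G, hGx, pullbackBilin_apply]
  show gP.val ((T ∘ (ψ ∘ jM)) x)
      ((mfderiv ((𝓡 (m + 1)).prod 𝓘(ℝ, ℝ)) (𝓡 (m + 2)) T ((ψ ∘ jM) x)) (mfderiv (𝓡∂ (m + 2)) ((𝓡 (m + 1)).prod 𝓘(ℝ, ℝ)) (ψ ∘ jM) x v))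
      ((mfderiv ((𝓡 (m + 1)).prod 𝓘(ℝ, ℝ)) (𝓡 (m + 2)) T ((ψ ∘ jM) x)) (mfderiv (𝓡∂ (m + 2)) ((𝓡 (m + 1)).prod 𝓘(ℝ, ℝ)) (ψ ∘ jM) x w)) = _
  rw [← ContinuousLinearMap.comp_apply (mfderiv ((𝓡 (m + 1)).prod 𝓘(ℝ, ℝ)) (𝓡 (m + 2)) T ((ψ ∘ jM) x)),
    ← ContinuousLinearMap.comp_apply (mfderiv ((𝓡 (m + 1)).prod 𝓘(ℝ, ℝ)) (𝓡 (m + 2)) T ((ψ ∘ jM) x)),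
    ← mfderiv_comp x hTd hΦd]
  rw [hev.mfderiv_eq]
  rw [hpt]
  exact hpull x v w

omit [IsManifold (𝓡∂ (m + 2)) ∞ X] [IsManifold (𝓡 (m + 2)) ∞ P] in
/-- **At the boundary the pulled-back metric is the slice form of the cylinder**:
`((ψ ∘ jM)^* G')_{incl z}(d incl v, d incl w) = G'_{(z,0)}((v,0),(w,0))`, because
`ψ ∘ jM ∘ incl` is the zero slice `z ↦ (z, 0)`. [folklore] -/
theorem pullback_fermi_incl {jM : X → P}
    (hjM : Manifold.IsSmoothEmbedding (𝓡∂ (m + 2)) (𝓡 (m + 2)) ∞ jM)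
    (T : bX.carrier × ℝ → P) (ψ : OpenPartialHomeomorph P (bX.carrier × ℝ)) {ε : ℝ} (hε : 0 < ε)
    (hsrc : ψ.source = T '' ((univ : Set bX.carrier) ×ˢ Ioo (-ε) ε))
    (hleft : ∀ q ∈ (univ : Set bX.carrier) ×ˢ Ioo (-ε) ε, ψ (T q) = q)
    (hψs : ContMDiffOn (𝓡 (m + 2)) ((𝓡 (m + 1)).prod 𝓘(ℝ, ℝ)) ∞ ψ ψ.source)
    (hT0 : ∀ z, T (z, 0) = jM (bX.incl z))
    (G' : PseudoRiemannianMetric ((𝓡 (m + 1)).prod 𝓘(ℝ, ℝ)) ∞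
      (EuclideanSpace ℝ (Fin (m + 1)) × ℝ)
      (TangentSpace ((𝓡 (m + 1)).prod 𝓘(ℝ, ℝ)) : bX.carrier × ℝ → Type _))
    (z : bX.carrier) (v w : EuclideanSpace ℝ (Fin (m + 1))) :
    pullbackBilin (I := (𝓡 (m + 1)).prod 𝓘(ℝ, ℝ)) (I' := 𝓡∂ (m + 2)) (ψ ∘ jM) G'.val (bX.incl z)
        (mfderiv (𝓡 (m + 1)) (𝓡∂ (m + 2)) bX.incl z v)
        (mfderiv (𝓡 (m + 1)) (𝓡∂ (m + 2)) bX.incl z w) =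
      G'.val (z, (0 : ℝ)) ((v, 0) : TangentSpace ((𝓡 (m + 1)).prod 𝓘(ℝ, ℝ)) (z, (0 : ℝ)))
        ((w, 0) : TangentSpace ((𝓡 (m + 1)).prod 𝓘(ℝ, ℝ)) (z, (0 : ℝ))) := by
  have h0mem : ((z, (0 : ℝ)) : bX.carrier × ℝ) ∈ (univ : Set bX.carrier) ×ˢ Ioo (-ε) ε :=
    ⟨mem_univ _, by simpa using hε, hε⟩
  have hx : jM (bX.incl z) ∈ ψ.source := by
    rw [hsrc, ← hT0]
    exact mem_image_of_mem T h0mem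
  have hΦd : MDifferentiableAt (𝓡∂ (m + 2)) ((𝓡 (m + 1)).prod 𝓘(ℝ, ℝ)) (ψ ∘ jM) (bX.incl z) :=
    (contMDiffAt_fermi_comp hjM ψ hψs hx).mdifferentiableAt (by simp)
  have hid : MDifferentiableAt (𝓡 (m + 1)) (𝓡∂ (m + 2)) bX.incl z :=
    (bX.isSmoothEmbedding.contMDiff z).mdifferentiableAt (by simp)
  -- `ψ ∘ jM ∘ incl` is the zero slice
  have hfun : (ψ ∘ jM) ∘ bX.incl = fun y : bX.carrier ↦ ((y, (0 : ℝ)) : bX.carrier × ℝ) := by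
    funext y
    show ψ (jM (bX.incl y)) = (y, 0)
    rw [← hT0]
    exact hleft _ ⟨mem_univ _, by simpa using hε, hε⟩
  -- chain rule: `d(ψ ∘ jM) ∘ d incl = d(zero slice) = (u ↦ (u, 0))`
  have hcomp : ∀ u : EuclideanSpace ℝ (Fin (m + 1)),
      (show EuclideanSpace ℝ (Fin (m + 1)) × ℝ from
        mfderiv (𝓡∂ (m + 2)) ((𝓡 (m + 1)).prod 𝓘(ℝ, ℝ)) (ψ ∘ jM) (bX.incl z)
          (mfderiv (𝓡 (m + 1)) (𝓡∂ (m + 2)) bX.incl z u)) = (u, 0) := by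
    intro u
    have h1 : mfderiv (𝓡∂ (m + 2)) ((𝓡 (m + 1)).prod 𝓘(ℝ, ℝ)) (ψ ∘ jM) (bX.incl z)
        (mfderiv (𝓡 (m + 1)) (𝓡∂ (m + 2)) bX.incl z u) =
        mfderiv (𝓡 (m + 1)) ((𝓡 (m + 1)).prod 𝓘(ℝ, ℝ)) ((ψ ∘ jM) ∘ bX.incl) z u := by
      rw [mfderiv_comp z hΦd hid]
      rfl
    rw [h1]
    show (show EuclideanSpace ℝ (Fin (m + 1)) × ℝ from
      mfderiv (𝓡 (m + 1)) ((𝓡 (m + 1)).prod 𝓘(ℝ, ℝ)) ((ψ ∘ jM) ∘ bX.incl) z u) = (u, 0)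
    rw [hfun]
    exact mfderiv_cylSlice_apply z 0 u
  have hpt : (ψ ∘ jM) (bX.incl z) = (z, (0 : ℝ)) := congrFun hfun z
  rw [pullbackBilin_apply]
  rw [val_apply_congr_point G' hpt]
  show G'.val (z, (0 : ℝ))
      (show EuclideanSpace ℝ (Fin (m + 1)) × ℝ from
        mfderiv (𝓡∂ (m + 2)) ((𝓡 (m + 1)).prod 𝓘(ℝ, ℝ)) (ψ ∘ jM) (bX.incl z)
          (mfderiv (𝓡 (m + 1)) (𝓡∂ (m + 2)) bX.incl z v))
      (show EuclideanSpace ℝ (Fin (m + 1)) × ℝ from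
        mfderiv (𝓡∂ (m + 2)) ((𝓡 (m + 1)).prod 𝓘(ℝ, ℝ)) (ψ ∘ jM) (bX.incl z)
          (mfderiv (𝓡 (m + 1)) (𝓡∂ (m + 2)) bX.incl z w)) = _
  rw [hcomp v, hcomp w]

/-! ### Patching a metric -/

section Patch

variable {EX : Type*} [NormedAddCommGroup EX] [NormedSpace ℝ EX] {HX : Type*}
  [TopologicalSpace HX] {IX : ModelWithCorners ℝ EX HX} {Y : Type*} [TopologicalSpace Y]
  [ChartedSpace HX Y] [IsManifold IX ∞ Y]

/-- **Patching a Riemannian metric on an open set.** Let `g` be a metric on `Y`, `U ⊆ Y` open,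
`K ⊆ U` closed, and `s` a field of bilinear forms which on `U` is a `C^∞` section, symmetric and
positive definite, and which agrees with `g` on `U \ K`. Then there is a Riemannian metric `g'`
with `g' = s` on `U` and `g' = g` off `K` (namely `s` on `U` and `g` elsewhere; smoothness is
local). [folklore] -/
theorem exists_metric_patch
    (g : PseudoRiemannianMetric IX ∞ EX (TangentSpace IX : Y → Type _)) (hg : g.IsRiemannian)
    (s : Π x : Y, TangentSpace IX x →L[ℝ] TangentSpace IX x →L[ℝ] ℝ)
    {U K : Set Y} (hU : IsOpen U) (hK : IsClosed K) (hKU : K ⊆ U)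
    (hs : ∀ x ∈ U, ContMDiffAt IX (IX.prod 𝓘(ℝ, EX →L[ℝ] EX →L[ℝ] ℝ)) ∞
      (fun y : Y ↦ TotalSpace.mk' (EX →L[ℝ] EX →L[ℝ] ℝ)
        (E := fun y : Y ↦ TangentSpace IX y →L[ℝ] TangentSpace IX y →L[ℝ] ℝ) y (s y)) x)
    (hsymm : ∀ x ∈ U, ∀ v w, s x v w = s x w v)
    (hpos : ∀ x ∈ U, ∀ v, v ≠ 0 → 0 < s x v v)
    (hagree : ∀ x ∈ U, x ∉ K → s x = g.val x) :
    ∃ g' : PseudoRiemannianMetric IX ∞ EX (TangentSpace IX : Y → Type _),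
      g'.IsRiemannian ∧ (∀ x ∈ U, g'.val x = s x) ∧ (∀ x, x ∉ K → g'.val x = g.val x) := by
  classical
  set val : Π x : Y, TangentSpace IX x →L[ℝ] TangentSpace IX x →L[ℝ] ℝ :=
    fun x ↦ if x ∈ U then s x else g.val x with hval
  have hvalU : ∀ x ∈ U, val x = s x := fun x hx ↦ if_pos hx
  have hvalU' : ∀ x, x ∉ U → val x = g.val x := fun x hx ↦ if_neg hx
  have hvalK : ∀ x, x ∉ K → val x = g.val x := by
    intro x hx
    by_cases hxU : x ∈ U
    · rw [hvalU x hxU, hagree x hxU hx]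
    · exact hvalU' x hxU
  have hpos' : ∀ x v, v ≠ 0 → 0 < val x v v := by
    intro x v hv
    by_cases hxU : x ∈ U
    · rw [hvalU x hxU]
      exact hpos x hxU v hv
    · rw [hvalU' x hxU]
      exact hg x v hv
  refine ⟨{ val := val, symm := ?_, nondegenerate := ?_, contMDiff := ?_ }, ?_, hvalU, hvalK⟩
  · intro x v w
    by_cases hxU : x ∈ U
    · rw [hvalU x hxU]
      exact hsymm x hxU v w
    · rw [hvalU' x hxU]
      exact g.symm x v w
  · intro x v hv
    by_contra h
    exact (hpos' x v h).ne' (hv v)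
  · intro x
    by_cases hxU : x ∈ U
    · have hev : (fun y : Y ↦ TotalSpace.mk' (EX →L[ℝ] EX →L[ℝ] ℝ)
          (E := fun y : Y ↦ TangentSpace IX y →L[ℝ] TangentSpace IX y →L[ℝ] ℝ) y (val y))
          =ᶠ[𝓝 x] (fun y : Y ↦ TotalSpace.mk' (EX →L[ℝ] EX →L[ℝ] ℝ)
            (E := fun y : Y ↦ TangentSpace IX y →L[ℝ] TangentSpace IX y →L[ℝ] ℝ) y (s y)) := by
        filter_upwards [hU.mem_nhds hxU] with y hy
        rw [hvalU y hy]
      exact (hs x hxU).congr_of_eventuallyEq hev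
    · have hxK : x ∉ K := fun h ↦ hxU (hKU h)
      have hev : (fun y : Y ↦ TotalSpace.mk' (EX →L[ℝ] EX →L[ℝ] ℝ)
          (E := fun y : Y ↦ TangentSpace IX y →L[ℝ] TangentSpace IX y →L[ℝ] ℝ) y (val y))
          =ᶠ[𝓝 x] (fun y : Y ↦ TotalSpace.mk' (EX →L[ℝ] EX →L[ℝ] ℝ)
            (E := fun y : Y ↦ TangentSpace IX y →L[ℝ] TangentSpace IX y →L[ℝ] ℝ) y
            (g.val y)) := by
        filter_upwards [hK.isOpen_compl.mem_nhds hxK] with y hy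
        rw [hvalK y hy]
      exact (g.contMDiff x).congr_of_eventuallyEq hev
  · intro x v hv
    exact hpos' x v hv

end Patch

/-! ### The deformed metric on the piece -/

set_option maxHeartbeats 800000 in
/-- **The deformed metric on `X`.** Given the boundary cylinder `G = T^*ĝ_P` of `(X, g)` on the
Fermi tube of width `ε` and a deformed cylinder metric `G'` which agrees with `G` for `t > ρ₁`,
has positive scalar curvature on `∂X × [0, ρ]` (`ρ₁ < ρ < ε`) and has the zero-slice form of `G`,
there is a Riemannian PSC metric `ĝ` on `X` with the boundary form of `g` which on the tube
`{t < ρ}` is `(ψ ∘ jM)^* G'` (and is `g` beyond). [folklore] -/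
theorem exists_deformedMetric [T2Space P] [CompactSpace X] [Nonempty X] {jM : X → P}
    (hjM : Manifold.IsSmoothEmbedding (𝓡∂ (m + 2)) (𝓡 (m + 2)) ∞ jM)
    (g : PseudoRiemannianMetric (𝓡∂ (m + 2)) ∞ (EuclideanSpace ℝ (Fin (m + 2)))
      (TangentSpace (𝓡∂ (m + 2)) : X → Type _)) [g.HasLeviCivita] (hgR : g.IsRiemannian)
    (hpsc : ∀ x, 0 < g.scalarCurvature x)
    (gP : PseudoRiemannianMetric (𝓡 (m + 2)) ∞ (EuclideanSpace ℝ (Fin (m + 2)))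
      (TangentSpace (𝓡 (m + 2)) : P → Type _)) [gP.HasLeviCivita]
    (hpull : ∀ (a : X) (v w : TangentSpace (𝓡∂ (m + 2)) a),
      gP.val (jM a) (mfderiv (𝓡∂ (m + 2)) (𝓡 (m + 2)) jM a v)
        (mfderiv (𝓡∂ (m + 2)) (𝓡 (m + 2)) jM a w) = g.val a v w)
    (T : bX.carrier × ℝ → P) (ψ : OpenPartialHomeomorph P (bX.carrier × ℝ)) {ε : ℝ} (hε : 0 < ε)
    (hTs : ∀ q : bX.carrier × ℝ, q.2 ∈ Ioo (-ε) ε →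
      ContMDiffAt ((𝓡 (m + 1)).prod 𝓘(ℝ, ℝ)) (𝓡 (m + 2)) ∞ T q)
    (hsrc : ψ.source = T '' ((univ : Set bX.carrier) ×ˢ Ioo (-ε) ε))
    (htgt : ψ.target = (univ : Set bX.carrier) ×ˢ Ioo (-ε) ε)
    (hsymm : ∀ q, ψ.symm q = T q)
    (hleft : ∀ q ∈ (univ : Set bX.carrier) ×ˢ Ioo (-ε) ε, ψ (T q) = q)
    (hψs : ContMDiffOn (𝓡 (m + 2)) ((𝓡 (m + 1)).prod 𝓘(ℝ, ℝ)) ∞ ψ ψ.source)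
    (hT0 : ∀ z, T (z, 0) = jM (bX.incl z))
    (hminus : ∀ (z : bX.carrier), ∀ t ∈ Ioo (-ε) 0, T (z, t) ∉ range jM)
    (G G' : PseudoRiemannianMetric ((𝓡 (m + 1)).prod 𝓘(ℝ, ℝ)) ∞
      (EuclideanSpace ℝ (Fin (m + 1)) × ℝ)
      (TangentSpace ((𝓡 (m + 1)).prod 𝓘(ℝ, ℝ)) : bX.carrier × ℝ → Type _)) [G'.HasLeviCivita]
    (hGval : ∀ (z : bX.carrier), ∀ t ∈ Ioo (-ε) ε,
      G.val (z, t) = pullbackBilin (I := 𝓡 (m + 2)) (I' := (𝓡 (m + 1)).prod 𝓘(ℝ, ℝ)) T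
        gP.val (z, t))
    (hG0 : ∀ (z : bX.carrier) (v w : EuclideanSpace ℝ (Fin (m + 1))),
      G.val (z, (0 : ℝ)) ((v, 0) : TangentSpace ((𝓡 (m + 1)).prod 𝓘(ℝ, ℝ)) (z, (0 : ℝ)))
        ((w, 0) : TangentSpace ((𝓡 (m + 1)).prod 𝓘(ℝ, ℝ)) (z, (0 : ℝ))) =
      g.val (bX.incl z) (mfderiv (𝓡 (m + 1)) (𝓡∂ (m + 2)) bX.incl z v)
        (mfderiv (𝓡 (m + 1)) (𝓡∂ (m + 2)) bX.incl z w))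
    (hG'R : G'.IsRiemannian) {ρ₁ ρ : ℝ} (hρ₁ : 0 < ρ₁) (hρ₁ρ : ρ₁ < ρ) (hρε : ρ < ε)
    (hG'G : ∀ (z : bX.carrier) (t : ℝ), ρ₁ < t → G'.val (z, t) = G.val (z, t))
    (hG'psc : ∀ (z : bX.carrier), ∀ t ∈ Icc (0 : ℝ) ρ, 0 < G'.scalarCurvature (z, t))
    (hG'0 : ∀ (z : bX.carrier) (v w : EuclideanSpace ℝ (Fin (m + 1))),
      G'.val (z, (0 : ℝ)) ((v, 0) : TangentSpace ((𝓡 (m + 1)).prod 𝓘(ℝ, ℝ)) (z, (0 : ℝ)))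
        ((w, 0) : TangentSpace ((𝓡 (m + 1)).prod 𝓘(ℝ, ℝ)) (z, (0 : ℝ))) =
      G.val (z, (0 : ℝ)) ((v, 0) : TangentSpace ((𝓡 (m + 1)).prod 𝓘(ℝ, ℝ)) (z, (0 : ℝ)))
        ((w, 0) : TangentSpace ((𝓡 (m + 1)).prod 𝓘(ℝ, ℝ)) (z, (0 : ℝ)))) :
    ∃ (ĝ : PseudoRiemannianMetric (𝓡∂ (m + 2)) ∞ (EuclideanSpace ℝ (Fin (m + 2)))
        (TangentSpace (𝓡∂ (m + 2)) : X → Type _)) (_ : ĝ.HasLeviCivita),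
      ĝ.IsRiemannian ∧ (∀ x, 0 < ĝ.scalarCurvature x) ∧
      (∀ z, pullbackBilin (I := 𝓡∂ (m + 2)) (I' := 𝓡 (m + 1)) bX.incl ĝ.val z =
        pullbackBilin (I := 𝓡∂ (m + 2)) (I' := 𝓡 (m + 1)) bX.incl g.val z) ∧
      (∀ x, jM x ∈ ψ.source → (ψ (jM x)).2 < ρ →
        ĝ.val x = pullbackBilin (I := (𝓡 (m + 1)).prod 𝓘(ℝ, ℝ)) (I' := 𝓡∂ (m + 2)) (ψ ∘ jM)
          G'.val x) := by
  haveI : Fact (1 ≤ (∞ : ℕ∞ω)) := ⟨by exact_mod_cast le_top⟩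
  haveI : CompactSpace bX.carrier := bX.compactSpace_carrier
  have hcont : Continuous jM := hjM.isEmbedding.continuous
  -- points of the tube: nonnegative height, `T ∘ ψ = id`
  have hsrc_mem : ∀ x : X, jM x ∈ ψ.source →
      0 ≤ (ψ (jM x)).2 ∧ (ψ (jM x)).2 < ε ∧ T (ψ (jM x)) = jM x := by
    intro x hx
    have htq : ψ (jM x) ∈ ψ.target := ψ.map_source hx
    rw [htgt] at htq
    have hTq : T (ψ (jM x)) = jM x := by rw [← hsymm]; exact ψ.left_inv hx
    refine ⟨?_, htq.2.2, hTq⟩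
    by_contra hneg
    push Not at hneg
    have hmem : T (ψ (jM x)) ∈ range jM := by
      rw [hTq]
      exact mem_range_self x
    exact hminus (ψ (jM x)).1 (ψ (jM x)).2 ⟨htq.2.1, hneg⟩ hmem
  -- the open tube `U = {t < ρ}` and the closed tube `K = {t ≤ ρ₁}`
  set U : Set X := {x | jM x ∈ ψ.source ∧ (ψ (jM x)).2 < ρ} with hU
  have hUopen : IsOpen U := by
    have h : U = jM ⁻¹' (ψ.source ∩ ψ ⁻¹' ((univ : Set bX.carrier) ×ˢ Iio ρ)) := by
      ext x
      simp [hU]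
    rw [h]
    exact (ψ.isOpen_inter_preimage (isOpen_univ.prod isOpen_Iio)).preimage hcont
  set K : Set X := jM ⁻¹' (T '' ((univ : Set bX.carrier) ×ˢ Icc 0 ρ₁)) with hK
  have hKclosed : IsClosed K := by
    have hTc : ContinuousOn T ((univ : Set bX.carrier) ×ˢ Icc 0 ρ₁) := fun q hq ↦
      (hTs q ⟨by linarith [hq.2.1], by linarith [hq.2.2]⟩).continuousAt.continuousWithinAt
    have hcpt : IsCompact (T '' ((univ : Set bX.carrier) ×ˢ Icc 0 ρ₁)) :=
      (isCompact_univ.prod isCompact_Icc).image_of_continuousOn hTc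
    exact hcpt.isClosed.preimage hcont
  have hKmem : ∀ x ∈ K, jM x ∈ ψ.source ∧ (ψ (jM x)).2 ≤ ρ₁ := by
    rintro x ⟨q, hq, hqx⟩
    have hq' : q ∈ (univ : Set bX.carrier) ×ˢ Ioo (-ε) ε :=
      ⟨mem_univ _, by linarith [hq.2.1], by linarith [hq.2.2]⟩
    have hxs : jM x ∈ ψ.source := by
      rw [hsrc, ← hqx]
      exact mem_image_of_mem T hq'
    refine ⟨hxs, ?_⟩
    rw [← hqx, hleft q hq']
    exact hq.2.2
  have hKU : K ⊆ U := fun x hx ↦ ⟨(hKmem x hx).1, (hKmem x hx).2.trans_lt hρ₁ρ⟩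
  have hnotK : ∀ x ∈ U, x ∉ K → ρ₁ < (ψ (jM x)).2 := by
    intro x hx hxK
    by_contra hle
    push Not at hle
    obtain ⟨h0, -, hTq⟩ := hsrc_mem x hx.1
    exact hxK ⟨ψ (jM x), ⟨mem_univ _, h0, hle⟩, hTq⟩
  -- the candidate `s = (ψ ∘ jM)^* G'` and its properties on `U`
  set s := pullbackBilin (I := (𝓡 (m + 1)).prod 𝓘(ℝ, ℝ)) (I' := 𝓡∂ (m + 2)) (ψ ∘ jM) G'.val
    with hs
  have hs_smooth := fun x (hx : x ∈ U) ↦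
    contMDiffAt_pullbackBilin_of_contMDiffAt (n := ∞) (contMDiffAt_fermi_comp hjM ψ hψs hx.1)
      (G'.contMDiff _)
  have hs_symm : ∀ x ∈ U, ∀ v w, s x v w = s x w v := fun x _ v w ↦
    pullbackBilin_symm _ G'.val G'.symm x v w
  have hs_pos : ∀ x ∈ U, ∀ v, v ≠ 0 → 0 < s x v v := by
    intro x hx v hv
    rw [hs, pullbackBilin_apply]
    refine hG'R _ _ fun h0 ↦ hv ?_
    exact injective_mfderiv_fermi_comp hjM T ψ hTs htgt hsymm hψs hx.1 (by rw [h0, map_zero])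
  have hs_agree : ∀ x ∈ U, x ∉ K → s x = g.val x := fun x hx hxK ↦
    pullback_fermi_eq_of_eq hjM g gP hpull T ψ hTs htgt hsymm hψs G G' hGval hx.1
      (by
        have h := hG'G (ψ (jM x)).1 (ψ (jM x)).2 (hnotK x hx hxK)
        rwa [Prod.mk.eta] at h)
  -- patch
  obtain ⟨ĝ, hĝR, hĝU, hĝK⟩ :=
    exists_metric_patch g hgR s hUopen hKclosed hKU hs_smooth hs_symm hs_pos hs_agree
  haveI hĝLC : ĝ.HasLeviCivita := ĝ.hasLeviCivita
  -- dimensions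
  have hdim : Module.finrank ℝ (EuclideanSpace ℝ (Fin (m + 2))) =
      Module.finrank ℝ (EuclideanSpace ℝ (Fin (m + 1)) × ℝ) := by
    rw [Module.finrank_prod, Module.finrank_self, finrank_euclideanSpace_fin,
      finrank_euclideanSpace_fin]
  -- scalar curvature on the tube: that of `G'`
  have hscalU : ∀ x ∈ U, ĝ.scalarCurvature x = G'.scalarCurvature ((ψ ∘ jM) x) := fun x hx ↦
    scalarCurvature_eq_of_val_eq_pullbackBilin G' ĝ hUopen
      (fun q hq ↦ contMDiffAt_fermi_comp hjM ψ hψs hq.1)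
      (fun q hq ↦ injective_mfderiv_fermi_comp hjM T ψ hTs htgt hsymm hψs hq.1) hdim
      (fun q hq ↦ hĝU q hq) hx
  -- scalar curvature off the closed tube: that of `g`
  have hvalK : ∀ q ∈ Kᶜ, ĝ.val q =
      pullbackBilin (I := 𝓡 (m + 2)) (I' := 𝓡∂ (m + 2)) jM gP.val q := by
    intro q hq
    rw [hĝK q hq]
    exact ContinuousLinearMap.ext fun v ↦ ContinuousLinearMap.ext fun w ↦
      (by rw [pullbackBilin_apply, hpull])
  have hvalg : ∀ q ∈ (univ : Set X), g.val q =
      pullbackBilin (I := 𝓡 (m + 2)) (I' := 𝓡∂ (m + 2)) jM gP.val q := fun q _ ↦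
    ContinuousLinearMap.ext fun v ↦ ContinuousLinearMap.ext fun w ↦
      (by rw [pullbackBilin_apply, hpull])
  have hscalK : ∀ x, x ∉ K → ĝ.scalarCurvature x = g.scalarCurvature x := by
    intro x hx
    have h1 := scalarCurvature_eq_of_val_eq_pullbackBilin gP ĝ hKclosed.isOpen_compl
      (fun q _ ↦ hjM.contMDiff q)
      (fun q _ ↦ injective_mfderiv_of_isImmersionAt' (hjM.isImmersion.isImmersionAt q)) rfl
      hvalK (q := x) hx
    have h2 := scalarCurvature_eq_of_val_eq_pullbackBilin gP g isOpen_univ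
      (fun q _ ↦ hjM.contMDiff q)
      (fun q _ ↦ injective_mfderiv_of_isImmersionAt' (hjM.isImmersion.isImmersionAt q)) rfl
      hvalg (q := x) (mem_univ x)
    rw [h1, h2]
  refine ⟨ĝ, hĝLC, hĝR, fun x ↦ ?_, fun z ↦ ?_, fun x hx hxρ ↦ hĝU x ⟨hx, hxρ⟩⟩
  · -- positive scalar curvature
    by_cases hx : x ∈ U
    · rw [hscalU x hx]
      obtain ⟨h0, -, -⟩ := hsrc_mem x hx.1
      have h := hG'psc (ψ (jM x)).1 (ψ (jM x)).2 ⟨h0, hx.2.le⟩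
      rwa [Prod.mk.eta] at h
    · rw [hscalK x fun h ↦ hx (hKU h)]
      exact hpsc x
  · -- the boundary form
    have h0mem : ((z, (0 : ℝ)) : bX.carrier × ℝ) ∈ (univ : Set bX.carrier) ×ˢ Ioo (-ε) ε :=
      ⟨mem_univ _, by simpa using hε, hε⟩
    have hzU : bX.incl z ∈ U := by
      have hxs : jM (bX.incl z) ∈ ψ.source := by
        rw [hsrc, ← hT0]
        exact mem_image_of_mem T h0mem
      refine ⟨hxs, ?_⟩
      rw [← hT0, hleft _ h0mem]
      exact hρ₁.trans hρ₁ρ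
    refine ContinuousLinearMap.ext fun v ↦ ContinuousLinearMap.ext fun w ↦ ?_
    rw [pullbackBilin_apply, pullbackBilin_apply, hĝU _ hzU, hs,
      pullback_fermi_incl hjM T ψ hε hsrc hleft hψs hT0 G' z v w, hG'0, hG0]

/-! ### The collar formula -/

section IccVal

open WithLp

/-- In the left chart of `[0, 1]` the inclusion into `ℝ` reads `v ↦ min (max v₀ 0) 1`.
[folklore] -/
theorem writtenInExtChartAt_val_Icc_of_lt (s : Icc (0 : ℝ) 1) (hs : s.val < 1)
    (v : EuclideanSpace ℝ (Fin 1)) :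
    writtenInExtChartAt (𝓡∂ 1) 𝓘(ℝ, ℝ) s (Subtype.val : Icc (0 : ℝ) 1 → ℝ) v =
      min (max (v.ofLp 0) 0) 1 := by
  simp [writtenInExtChartAt, extChartAt, chartAt, hs, IccLeftChart,
    modelWithCornersEuclideanHalfSpace]

/-- In the right chart of `[0, 1]` (at the top) the inclusion reads `v ↦ max (1 - max v₀ 0) 0`.
[folklore] -/
theorem writtenInExtChartAt_val_Icc_of_not_lt (s : Icc (0 : ℝ) 1) (hs : ¬ s.val < 1)
    (v : EuclideanSpace ℝ (Fin 1)) :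
    writtenInExtChartAt (𝓡∂ 1) 𝓘(ℝ, ℝ) s (Subtype.val : Icc (0 : ℝ) 1 → ℝ) v =
      max (1 - max (v.ofLp 0) 0) 0 := by
  simp [writtenInExtChartAt, extChartAt, chartAt, hs, IccRightChart,
    modelWithCornersEuclideanHalfSpace]

/-- The left chart sends `s < 1` to the vector `(s)`. [folklore] -/
theorem extChartAt_Icc_self_of_lt (s : Icc (0 : ℝ) 1) (hs : s.val < 1) :
    extChartAt (𝓡∂ 1) s s = toLp 2 (fun _ ↦ s.val) := by
  simp [extChartAt, chartAt, hs, IccLeftChart, modelWithCornersEuclideanHalfSpace]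

/-- The right chart sends the top `s = 1` to the vector `(1 - s) = 0`. [folklore] -/
theorem extChartAt_Icc_self_of_not_lt (s : Icc (0 : ℝ) 1) (hs : ¬ s.val < 1) :
    extChartAt (𝓡∂ 1) s s = toLp 2 (fun _ ↦ 1 - s.val) := by
  simp [extChartAt, chartAt, hs, IccRightChart, modelWithCornersEuclideanHalfSpace]

/-- The model half-line: `range (𝓡∂ 1) = {v | 0 ≤ v₀}`. [folklore] -/
theorem range_modelWithCornersEuclideanHalfSpace_one :
    range (𝓡∂ 1) = {v : EuclideanSpace ℝ (Fin 1) | 0 ≤ v.ofLp 0} := by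
  simp [range_modelWithCornersEuclideanHalfSpace]

/-- **The differential of the inclusion `[0, 1] ⊆ ℝ` in coordinates**: at every `s ∈ [0, 1]`
there is a sign `σ = ±1` (`+1` in the left chart, `-1` at the top, whose preferred chart
`t ↦ 1 - t` reverses the orientation) with `d(val)_s V = σ V₀` for all tangent vectors `V`
(coordinates in the preferred chart at `s`). [folklore] -/
theorem mfderiv_subtype_val_Icc (s : Icc (0 : ℝ) 1) :
    ∃ σ : ℝ, σ ^ 2 = 1 ∧ ∀ V : TangentSpace (𝓡∂ 1) s,
      mfderiv (𝓡∂ 1) 𝓘(ℝ, ℝ) (Subtype.val : Icc (0 : ℝ) 1 → ℝ) s V =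
        σ * (show EuclideanSpace ℝ (Fin 1) from V) 0 := by
  have hmd : MDifferentiableAt (𝓡∂ 1) 𝓘(ℝ, ℝ) (Subtype.val : Icc (0 : ℝ) 1 → ℝ) s :=
    (contMDiff_subtype_coe_Icc (n := 1)).mdifferentiableAt one_ne_zero
  set p : EuclideanSpace ℝ (Fin 1) := extChartAt (𝓡∂ 1) s s with hp
  have hpS : p ∈ range (𝓡∂ 1) := extChartAt_target_subset_range s (mem_extChartAt_target s)
  have hU : UniqueDiffWithinAt ℝ (range (𝓡∂ 1)) p := (𝓡∂ 1).uniqueDiffOn p hpS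
  set π₀ : EuclideanSpace ℝ (Fin 1) →L[ℝ] ℝ := PiLp.proj 2 (fun _ : Fin 1 ↦ ℝ) 0 with hπ₀
  have hπ₀v : ∀ v : EuclideanSpace ℝ (Fin 1), π₀ v = v.ofLp 0 := fun v ↦ rfl
  have hopen : IsOpen {v : EuclideanSpace ℝ (Fin 1) | v.ofLp 0 < 1} :=
    isOpen_Iio.preimage π₀.continuous
  rw [hmd.mfderiv]
  by_cases hs : s.val < 1
  · refine ⟨1, by norm_num, fun V ↦ ?_⟩
    have hp' : p = toLp 2 (fun _ ↦ s.val) := extChartAt_Icc_self_of_lt s hs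
    have hev : writtenInExtChartAt (𝓡∂ 1) 𝓘(ℝ, ℝ) s (Subtype.val : Icc (0 : ℝ) 1 → ℝ)
        =ᶠ[𝓝[range (𝓡∂ 1)] p] fun v ↦ π₀ v := by
      have hpmem : p ∈ {v : EuclideanSpace ℝ (Fin 1) | v.ofLp 0 < 1} := by
        rw [hp']
        simpa using hs
      filter_upwards [mem_nhdsWithin_of_mem_nhds (hopen.mem_nhds hpmem), self_mem_nhdsWithin]
        with v hv1 hvS
      rw [range_modelWithCornersEuclideanHalfSpace_one] at hvS
      have hvS' : 0 ≤ v.ofLp 0 := hvS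
      rw [writtenInExtChartAt_val_Icc_of_lt s hs v, hπ₀v, max_eq_left hvS', min_eq_left hv1.le]
    rw [hev.fderivWithin_eq (hev.eq_of_nhdsWithin hpS),
      π₀.hasFDerivAt.hasFDerivWithinAt.fderivWithin hU, one_mul]
    rfl
  · refine ⟨-1, by norm_num, fun V ↦ ?_⟩
    have hs1 : s.val = 1 := le_antisymm s.2.2 (not_lt.mp hs)
    have hp' : p = 0 := by
      rw [hp, extChartAt_Icc_self_of_not_lt s hs, hs1, sub_self]
      rfl
    have hev : writtenInExtChartAt (𝓡∂ 1) 𝓘(ℝ, ℝ) s (Subtype.val : Icc (0 : ℝ) 1 → ℝ)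
        =ᶠ[𝓝[range (𝓡∂ 1)] p] fun v ↦ 1 - π₀ v := by
      have hpmem : p ∈ {v : EuclideanSpace ℝ (Fin 1) | v.ofLp 0 < 1} := by
        rw [hp']
        simp
      filter_upwards [mem_nhdsWithin_of_mem_nhds (hopen.mem_nhds hpmem), self_mem_nhdsWithin]
        with v hv1 hvS
      rw [range_modelWithCornersEuclideanHalfSpace_one] at hvS
      have hvS' : 0 ≤ v.ofLp 0 := hvS
      have hv1' : 0 ≤ 1 - v.ofLp 0 := by linarith [hv1.le]
      rw [writtenInExtChartAt_val_Icc_of_not_lt s hs v, hπ₀v, max_eq_left hvS', max_eq_left hv1']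
    rw [hev.fderivWithin_eq (hev.eq_of_nhdsWithin hpS),
      ((hasFDerivAt_const (1 : ℝ) p).fun_sub π₀.hasFDerivAt).hasFDerivWithinAt.fderivWithin hU]
    simp
    rfl

/-- **The differential of the collar rescaling** `σ(z, s) = (z, εc s) : ∂X × [0, 1] → ∂X × ℝ`:
`dσ_{(z,s)}(V) = (V.1, εc · d(val)_s V.2)`. [folklore] -/
theorem mfderiv_collarScale {N : Type*} [TopologicalSpace N]
    [ChartedSpace (EuclideanSpace ℝ (Fin (m + 1))) N] (εc : ℝ)
    (p : N × Set.Icc (0 : ℝ) 1) (V : TangentSpace ((𝓡 (m + 1)).prod (𝓡∂ 1)) p) :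
    mfderiv ((𝓡 (m + 1)).prod (𝓡∂ 1)) ((𝓡 (m + 1)).prod 𝓘(ℝ, ℝ))
        (fun q : N × Set.Icc (0 : ℝ) 1 ↦ ((q.1, εc * (q.2 : ℝ)) : N × ℝ)) p V =
      ((V.1, εc * (show ℝ from
          mfderiv (𝓡∂ 1) 𝓘(ℝ, ℝ) (Subtype.val : Icc (0 : ℝ) 1 → ℝ) p.2 V.2)) :
        TangentSpace ((𝓡 (m + 1)).prod 𝓘(ℝ, ℝ)) (p.1, εc * (p.2 : ℝ))) := by
  have hval : MDifferentiableAt (𝓡∂ 1) 𝓘(ℝ, ℝ) (Subtype.val : Icc (0 : ℝ) 1 → ℝ) p.2 :=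
    (contMDiff_subtype_coe_Icc (n := 1)).mdifferentiableAt one_ne_zero
  have hmul : HasMFDerivAt 𝓘(ℝ, ℝ) 𝓘(ℝ, ℝ) (fun t : ℝ ↦ εc * t) (p.2 : ℝ)
      (εc • ContinuousLinearMap.id ℝ ℝ) :=
    hasMFDerivAt_iff_hasFDerivAt.mpr ((hasFDerivAt_id (p.2 : ℝ)).const_mul εc)
  have h2 : HasMFDerivAt (𝓡∂ 1) 𝓘(ℝ, ℝ) (fun s : Icc (0 : ℝ) 1 ↦ εc * (s : ℝ)) p.2
      ((εc • ContinuousLinearMap.id ℝ ℝ).comp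
        (mfderiv (𝓡∂ 1) 𝓘(ℝ, ℝ) (Subtype.val : Icc (0 : ℝ) 1 → ℝ) p.2)) :=
    hmul.comp p.2 hval.hasMFDerivAt
  have h2' : HasMFDerivAt ((𝓡 (m + 1)).prod (𝓡∂ 1)) 𝓘(ℝ, ℝ)
      (fun q : N × Set.Icc (0 : ℝ) 1 ↦ εc * (q.2 : ℝ)) p
      (((εc • ContinuousLinearMap.id ℝ ℝ).comp
        (mfderiv (𝓡∂ 1) 𝓘(ℝ, ℝ) (Subtype.val : Icc (0 : ℝ) 1 → ℝ) p.2)).comp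
        (ContinuousLinearMap.snd ℝ (TangentSpace (𝓡 (m + 1)) p.1)
          (TangentSpace (𝓡∂ 1) p.2))) :=
    h2.comp p (hasMFDerivAt_snd p)
  have h1 : HasMFDerivAt ((𝓡 (m + 1)).prod (𝓡∂ 1)) (𝓡 (m + 1))
      (fun q : N × Set.Icc (0 : ℝ) 1 ↦ q.1) p
      (ContinuousLinearMap.fst ℝ (TangentSpace (𝓡 (m + 1)) p.1) (TangentSpace (𝓡∂ 1) p.2)) :=
    hasMFDerivAt_fst p
  rw [(h1.prodMk h2').mfderiv]
  rfl

end IccVal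

omit [IsManifold (𝓡 (m + 2)) ∞ P] in
/-- **The metric in the geodesic collar.** If `ĝ = (ψ ∘ jM)^* G'` on the tube `{t < ρ}` and the
collar `c` satisfies `jM (c (z, s)) = T (z, εc s)` with `εc < ρ`, then for tangent vectors
`V, W` at `p = (z, s)`:
`(c^* ĝ)_p(V, W) = εc² V.2₀ W.2₀ + G'_{(z, εc s)}((V.1, 0), (W.1, 0))` (cylinder property of
`G'`, chain rule, `d(val) V.2 = ± V.2₀`). [folklore] -/
theorem collar_pullback_eq {jM : X → P}
    (hjM : Manifold.IsSmoothEmbedding (𝓡∂ (m + 2)) (𝓡 (m + 2)) ∞ jM)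
    (ĝ : PseudoRiemannianMetric (𝓡∂ (m + 2)) ∞ (EuclideanSpace ℝ (Fin (m + 2)))
      (TangentSpace (𝓡∂ (m + 2)) : X → Type _))
    (T : bX.carrier × ℝ → P) (ψ : OpenPartialHomeomorph P (bX.carrier × ℝ)) {ε : ℝ}
    (hsrc : ψ.source = T '' ((univ : Set bX.carrier) ×ˢ Ioo (-ε) ε))
    (hleft : ∀ q ∈ (univ : Set bX.carrier) ×ˢ Ioo (-ε) ε, ψ (T q) = q)
    (hψs : ContMDiffOn (𝓡 (m + 2)) ((𝓡 (m + 1)).prod 𝓘(ℝ, ℝ)) ∞ ψ ψ.source)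
    (G' : PseudoRiemannianMetric ((𝓡 (m + 1)).prod 𝓘(ℝ, ℝ)) ∞
      (EuclideanSpace ℝ (Fin (m + 1)) × ℝ)
      (TangentSpace ((𝓡 (m + 1)).prod 𝓘(ℝ, ℝ)) : bX.carrier × ℝ → Type _))
    (hG'cyl : ∀ (p : bX.carrier × ℝ) (v w : TangentSpace ((𝓡 (m + 1)).prod 𝓘(ℝ, ℝ)) p),
      G'.val p v w = G'.val p ((v.1, 0) : TangentSpace ((𝓡 (m + 1)).prod 𝓘(ℝ, ℝ)) p)
        ((w.1, 0) : TangentSpace ((𝓡 (m + 1)).prod 𝓘(ℝ, ℝ)) p) + v.2 * w.2)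
    {ρ : ℝ} (hρε : ρ < ε)
    (hĝU : ∀ x, jM x ∈ ψ.source → (ψ (jM x)).2 < ρ →
      ĝ.val x = pullbackBilin (I := (𝓡 (m + 1)).prod 𝓘(ℝ, ℝ)) (I' := 𝓡∂ (m + 2)) (ψ ∘ jM)
        G'.val x)
    {εc : ℝ} (hεc : 0 < εc) (hεcρ : εc < ρ) (c : bX.Collar)
    (hc : ∀ p : bX.carrier × Set.Icc (0 : ℝ) 1, jM (c p) = T (p.1, εc * (p.2 : ℝ)))
    (p : bX.carrier × Set.Icc (0 : ℝ) 1) (V W : TangentSpace ((𝓡 (m + 1)).prod (𝓡∂ 1)) p) :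
    pullbackBilin (I := 𝓡∂ (m + 2)) (I' := (𝓡 (m + 1)).prod (𝓡∂ 1)) c ĝ.val p V W =
      εc ^ 2 * ((show EuclideanSpace ℝ (Fin 1) from V.2) 0 *
        (show EuclideanSpace ℝ (Fin 1) from W.2) 0) +
      G'.val (p.1, εc * (p.2 : ℝ))
        ((V.1, 0) : TangentSpace ((𝓡 (m + 1)).prod 𝓘(ℝ, ℝ)) (p.1, εc * (p.2 : ℝ)))
        ((W.1, 0) : TangentSpace ((𝓡 (m + 1)).prod 𝓘(ℝ, ℝ)) (p.1, εc * (p.2 : ℝ))) := by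
  have hε : 0 < ε := by linarith
  -- the point `c p` lies in the tube `{t < ρ}`
  have ht0 : 0 ≤ εc * (p.2 : ℝ) := mul_nonneg hεc.le p.2.2.1
  have ht1 : εc * (p.2 : ℝ) ≤ εc := by nlinarith [p.2.2.2]
  have hq : ((p.1, εc * (p.2 : ℝ)) : bX.carrier × ℝ) ∈ (univ : Set bX.carrier) ×ˢ Ioo (-ε) ε :=
    ⟨mem_univ _, by linarith, by linarith⟩
  have hx : jM (c p) ∈ ψ.source := by
    rw [hsrc, hc p]
    exact mem_image_of_mem T hq
  have hψx : ψ (jM (c p)) = (p.1, εc * (p.2 : ℝ)) := by rw [hc p, hleft _ hq]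
  have hxρ : (ψ (jM (c p))).2 < ρ := by
    rw [hψx]
    linarith
  -- differentiability
  have hΦd : MDifferentiableAt (𝓡∂ (m + 2)) ((𝓡 (m + 1)).prod 𝓘(ℝ, ℝ)) (ψ ∘ jM) (c p) :=
    (contMDiffAt_fermi_comp hjM ψ hψs hx).mdifferentiableAt (by simp)
  have hcd : MDifferentiableAt ((𝓡 (m + 1)).prod (𝓡∂ 1)) (𝓡∂ (m + 2)) c p :=
    (c.isSmoothEmbedding.contMDiff p).mdifferentiableAt (by simp)
  -- `ψ ∘ jM ∘ c` is the rescaling `σ`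
  have hfun : (ψ ∘ jM) ∘ (c : bX.carrier × Set.Icc (0 : ℝ) 1 → X) =
      fun q : bX.carrier × Set.Icc (0 : ℝ) 1 ↦ ((q.1, εc * (q.2 : ℝ)) : bX.carrier × ℝ) := by
    funext q
    have hq' : ((q.1, εc * (q.2 : ℝ)) : bX.carrier × ℝ) ∈
        (univ : Set bX.carrier) ×ˢ Ioo (-ε) ε :=
      ⟨mem_univ _, by nlinarith [q.2.2.1], by nlinarith [q.2.2.2]⟩
    show ψ (jM (c q)) = (q.1, εc * (q.2 : ℝ))
    rw [hc q, hleft _ hq']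
  -- chain rule in coordinates
  obtain ⟨σ₀, hσ₀, hval⟩ := mfderiv_subtype_val_Icc p.2
  have hcomp : ∀ U : TangentSpace ((𝓡 (m + 1)).prod (𝓡∂ 1)) p,
      (show EuclideanSpace ℝ (Fin (m + 1)) × ℝ from
        mfderiv (𝓡∂ (m + 2)) ((𝓡 (m + 1)).prod 𝓘(ℝ, ℝ)) (ψ ∘ jM) (c p)
          (mfderiv ((𝓡 (m + 1)).prod (𝓡∂ 1)) (𝓡∂ (m + 2)) c p U)) =
        (U.1, εc * (σ₀ * (show EuclideanSpace ℝ (Fin 1) from U.2) 0)) := by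
    intro U
    have h1 : mfderiv (𝓡∂ (m + 2)) ((𝓡 (m + 1)).prod 𝓘(ℝ, ℝ)) (ψ ∘ jM) (c p)
        (mfderiv ((𝓡 (m + 1)).prod (𝓡∂ 1)) (𝓡∂ (m + 2)) c p U) =
        mfderiv ((𝓡 (m + 1)).prod (𝓡∂ 1)) ((𝓡 (m + 1)).prod 𝓘(ℝ, ℝ))
          ((ψ ∘ jM) ∘ (c : bX.carrier × Set.Icc (0 : ℝ) 1 → X)) p U := by
      rw [mfderiv_comp p hΦd hcd]
      rfl
    rw [h1]
    show (show EuclideanSpace ℝ (Fin (m + 1)) × ℝ from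
      mfderiv ((𝓡 (m + 1)).prod (𝓡∂ 1)) ((𝓡 (m + 1)).prod 𝓘(ℝ, ℝ))
        ((ψ ∘ jM) ∘ (c : bX.carrier × Set.Icc (0 : ℝ) 1 → X)) p U) = _
    rw [hfun, mfderiv_collarScale εc p U, hval U.2]
  have hpt : (ψ ∘ jM) (c p) = (p.1, εc * (p.2 : ℝ)) := hψx
  rw [pullbackBilin_apply, hĝU (c p) hx hxρ, pullbackBilin_apply, val_apply_congr_point G' hpt]
  show G'.val (p.1, εc * (p.2 : ℝ))
      (show EuclideanSpace ℝ (Fin (m + 1)) × ℝ from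
        mfderiv (𝓡∂ (m + 2)) ((𝓡 (m + 1)).prod 𝓘(ℝ, ℝ)) (ψ ∘ jM) (c p)
          (mfderiv ((𝓡 (m + 1)).prod (𝓡∂ 1)) (𝓡∂ (m + 2)) c p V))
      (show EuclideanSpace ℝ (Fin (m + 1)) × ℝ from
        mfderiv (𝓡∂ (m + 2)) ((𝓡 (m + 1)).prod 𝓘(ℝ, ℝ)) (ψ ∘ jM) (c p)
          (mfderiv ((𝓡 (m + 1)).prod (𝓡∂ 1)) (𝓡∂ (m + 2)) c p W)) = _
  rw [hcomp V, hcomp W, hG'cyl]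
  have hsq : εc * (σ₀ * (show EuclideanSpace ℝ (Fin 1) from V.2) 0) *
      (εc * (σ₀ * (show EuclideanSpace ℝ (Fin 1) from W.2) 0)) =
      εc ^ 2 * ((show EuclideanSpace ℝ (Fin 1) from V.2) 0 *
        (show EuclideanSpace ℝ (Fin 1) from W.2) 0) := by
    have h : σ₀ * σ₀ = 1 := by nlinarith [hσ₀]
    linear_combination (εc ^ 2 * (show EuclideanSpace ℝ (Fin 1) from V.2) 0 *
      (show EuclideanSpace ℝ (Fin 1) from W.2) 0) * h
  simp only [hsq]
  ring

/-! ### The geodesic collar -/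

omit [IsManifold (𝓡 (m + 2)) ∞ P] in
/-- **The geodesic collar.** From the Fermi data of the boundary (normal geodesics `T`, Fermi
chart `ψ`, piece embedding `jM`) and a scale `εc` with `2 εc < ε`, a collar `c` of `bX` with
`jM (c (z, s)) = T (z, εc s)`. [folklore] -/
theorem exists_collar_of_fermiData [Nonempty X] {jM : X → P}
    (hjM : Manifold.IsSmoothEmbedding (𝓡∂ (m + 2)) (𝓡 (m + 2)) ∞ jM)
    (T : bX.carrier × ℝ → P) (ψ : OpenPartialHomeomorph P (bX.carrier × ℝ)) {ε : ℝ}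
    (hTs : ∀ q : bX.carrier × ℝ, q.2 ∈ Ioo (-ε) ε →
      ContMDiffAt ((𝓡 (m + 1)).prod 𝓘(ℝ, ℝ)) (𝓡 (m + 2)) ∞ T q)
    (hsrc : ψ.source = T '' ((univ : Set bX.carrier) ×ˢ Ioo (-ε) ε))
    (htgt : ψ.target = (univ : Set bX.carrier) ×ˢ Ioo (-ε) ε)
    (hsymm : ∀ q, ψ.symm q = T q)
    (hleft : ∀ q ∈ (univ : Set bX.carrier) ×ˢ Ioo (-ε) ε, ψ (T q) = q)
    (hψs : ContMDiffOn (𝓡 (m + 2)) ((𝓡 (m + 1)).prod 𝓘(ℝ, ℝ)) ∞ ψ ψ.source)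
    (hT0 : ∀ z, T (z, 0) = jM (bX.incl z))
    (hplus : ∀ (z : bX.carrier), ∀ t ∈ Ioo 0 ε, T (z, t) ∈ range jM)
    (hminus : ∀ (z : bX.carrier), ∀ t ∈ Ioo (-ε) 0, T (z, t) ∉ range jM)
    {εc : ℝ} (hεc : 0 < εc) (h2εc : 2 * εc < ε) :
    ∃ c : bX.Collar, ∀ p : bX.carrier × Set.Icc (0 : ℝ) 1,
      c p = invFun jM (T (p.1, εc * (p.2 : ℝ))) ∧ jM (c p) = T (p.1, εc * (p.2 : ℝ)) := by
  have hε : 0 < ε := by linarith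
  have hinj : Injective jM := hjM.isEmbedding.injective
  have hli : LeftInverse (invFun jM) jM := leftInverse_invFun hinj
  -- `T (z, t) ∈ range jM` for `0 ≤ t < ε`
  have hrange : ∀ (z : bX.carrier) (t : ℝ), 0 ≤ t → t < ε → T (z, t) ∈ range jM := by
    intro z t ht0 htε
    rcases ht0.eq_or_lt with rfl | ht0
    · exact ⟨bX.incl z, (hT0 z).symm⟩
    · exact hplus z t ⟨ht0, htε⟩
  have hjT : ∀ (z : bX.carrier) (t : ℝ), 0 ≤ t → t < ε →
      jM (invFun jM (T (z, t))) = T (z, t) := fun z t ht0 htε ↦ invFun_eq (hrange z t ht0 htε)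
  -- points of the source have nonnegative height
  have hsrc_mem : ∀ x : X, jM x ∈ ψ.source →
      0 ≤ (ψ (jM x)).2 ∧ (ψ (jM x)).2 < ε ∧ T (ψ (jM x)) = jM x := by
    intro x hx
    have htq : ψ (jM x) ∈ ψ.target := ψ.map_source hx
    rw [htgt] at htq
    have hTq : T (ψ (jM x)) = jM x := by rw [← hsymm]; exact ψ.left_inv hx
    refine ⟨?_, htq.2.2, hTq⟩
    by_contra hneg
    push Not at hneg
    have hmem : T (ψ (jM x)) ∈ range jM := by
      rw [hTq]
      exact mem_range_self x
    exact hminus (ψ (jM x)).1 (ψ (jM x)).2 ⟨htq.2.1, hneg⟩ hmem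
  -- the open collar data
  set D : bX.OpenCollarData :=
    { toFun := fun z t ↦ invFun jM (T (z, εc * t))
      proj := fun x ↦ (ψ (jM x)).1
      height := fun x ↦ (ψ (jM x)).2 / εc
      top := 2
      region := {x | jM x ∈ ψ.source ∧ (ψ (jM x)).2 < εc * 2}
      one_lt_top := one_lt_two
      isOpen_region := by
        have h : {x : X | jM x ∈ ψ.source ∧ (ψ (jM x)).2 < εc * 2} =
            jM ⁻¹' (ψ.source ∩ ψ ⁻¹' ((univ : Set bX.carrier) ×ˢ Iio (εc * 2))) := by
          ext x
          simp
        rw [h]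
        exact (ψ.isOpen_inter_preimage (isOpen_univ.prod isOpen_Iio)).preimage
          hjM.isEmbedding.continuous
      apply_zero := fun z ↦ by
        show invFun jM (T (z, εc * 0)) = bX.incl z
        rw [mul_zero, hT0, hli]
      mem_region := by
        intro z t ht
        have h0 : 0 ≤ εc * t := mul_nonneg hεc.le ht.1
        have h1 : εc * t < ε := by nlinarith [ht.2]
        have hq : ((z, εc * t) : bX.carrier × ℝ) ∈ (univ : Set bX.carrier) ×ˢ Ioo (-ε) ε :=
          ⟨mem_univ _, by linarith, h1⟩
        refine ⟨?_, ?_⟩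
        · show jM (invFun jM (T (z, εc * t))) ∈ ψ.source
          rw [hjT z _ h0 h1, hsrc]
          exact mem_image_of_mem T hq
        · show (ψ (jM (invFun jM (T (z, εc * t))))).2 < εc * 2
          rw [hjT z _ h0 h1, hleft _ hq]
          nlinarith [ht.2]
      proj_apply := by
        intro z t ht
        have h0 : 0 ≤ εc * t := mul_nonneg hεc.le ht.1
        have h1 : εc * t < ε := by nlinarith [ht.2]
        have hq : ((z, εc * t) : bX.carrier × ℝ) ∈ (univ : Set bX.carrier) ×ˢ Ioo (-ε) ε :=
          ⟨mem_univ _, by linarith, h1⟩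
        show (ψ (jM (invFun jM (T (z, εc * t))))).1 = z
        rw [hjT z _ h0 h1, hleft _ hq]
      height_apply := by
        intro z t ht
        have h0 : 0 ≤ εc * t := mul_nonneg hεc.le ht.1
        have h1 : εc * t < ε := by nlinarith [ht.2]
        have hq : ((z, εc * t) : bX.carrier × ℝ) ∈ (univ : Set bX.carrier) ×ˢ Ioo (-ε) ε :=
          ⟨mem_univ _, by linarith, h1⟩
        show (ψ (jM (invFun jM (T (z, εc * t))))).2 / εc = t
        rw [hjT z _ h0 h1, hleft _ hq]
        field_simp
      height_mem := by
        rintro x ⟨hx, hx2⟩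
        obtain ⟨h0, -, -⟩ := hsrc_mem x hx
        refine ⟨div_nonneg h0 hεc.le, ?_⟩
        show (ψ (jM x)).2 / εc < 2
        rw [div_lt_iff₀ hεc]
        linarith
      apply_proj_height := by
        rintro x ⟨hx, -⟩
        obtain ⟨-, -, hTq⟩ := hsrc_mem x hx
        show invFun jM (T ((ψ (jM x)).1, εc * ((ψ (jM x)).2 / εc))) = x
        rw [mul_div_cancel₀ _ hεc.ne', Prod.mk.eta, hTq, hli]
      contMDiffOn_toFun := by
        -- `invFun jM ∘ T ∘ (scaling)` on `∂M × [0, 2)`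
        have hscale : ContMDiff ((𝓡 (m + 1)).prod 𝓘(ℝ, ℝ)) ((𝓡 (m + 1)).prod 𝓘(ℝ, ℝ)) ∞
            (fun q : bX.carrier × ℝ ↦ ((q.1, εc * q.2) : bX.carrier × ℝ)) :=
          contMDiff_fst.prodMk
            (((contDiff_const (c := εc)).mul contDiff_id).contMDiff.comp contMDiff_snd)
        have hTon : ContMDiffOn ((𝓡 (m + 1)).prod 𝓘(ℝ, ℝ)) (𝓡 (m + 2)) ∞ T
            ((univ : Set bX.carrier) ×ˢ Ioo (-ε) ε) := fun q hq ↦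
          (hTs q hq.2).contMDiffWithinAt
        have hinv : ContMDiffOn (𝓡 (m + 2)) (𝓡∂ (m + 2)) ∞ (invFun jM) (range jM) :=
          contMDiffOn_invFun_range hjM
        have h1 : ContMDiffOn ((𝓡 (m + 1)).prod 𝓘(ℝ, ℝ)) (𝓡 (m + 2)) ∞
            (T ∘ fun q : bX.carrier × ℝ ↦ ((q.1, εc * q.2) : bX.carrier × ℝ))
            ((univ : Set bX.carrier) ×ˢ Ico 0 2) := by
          refine hTon.comp hscale.contMDiffOn ?_
          rintro ⟨z, t⟩ ⟨-, ht⟩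
          exact ⟨mem_univ _, by nlinarith [ht.1], by nlinarith [ht.2]⟩
        have h2 := hinv.comp h1 (by
          rintro ⟨z, t⟩ ⟨-, ht⟩
          exact hrange z _ (mul_nonneg hεc.le ht.1) (by nlinarith [ht.2]))
        refine h2.congr ?_
        rintro ⟨z, t⟩ -
        rfl
      contMDiffOn_proj := by
        have h1 : ContMDiffOn (𝓡∂ (m + 2)) ((𝓡 (m + 1)).prod 𝓘(ℝ, ℝ)) ∞ (ψ ∘ jM)
            {x | jM x ∈ ψ.source ∧ (ψ (jM x)).2 < εc * 2} :=
          hψs.comp hjM.contMDiff.contMDiffOn fun x hx ↦ hx.1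
        exact contMDiff_fst.comp_contMDiffOn h1
      contMDiffOn_height := by
        have h1 : ContMDiffOn (𝓡∂ (m + 2)) ((𝓡 (m + 1)).prod 𝓘(ℝ, ℝ)) ∞ (ψ ∘ jM)
            {x | jM x ∈ ψ.source ∧ (ψ (jM x)).2 < εc * 2} :=
          hψs.comp hjM.contMDiff.contMDiffOn fun x hx ↦ hx.1
        have h2 : ContMDiffOn (𝓡∂ (m + 2)) 𝓘(ℝ, ℝ) ∞ (fun x ↦ (ψ (jM x)).2)
            {x | jM x ∈ ψ.source ∧ (ψ (jM x)).2 < εc * 2} :=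
          contMDiff_snd.comp_contMDiffOn h1
        exact ((contDiff_id (𝕜 := ℝ) (E := ℝ)).div_const εc).contMDiff.comp_contMDiffOn h2 }
    with hD
  refine ⟨D.toCollar, fun p ↦ ⟨rfl, ?_⟩⟩
  show jM (invFun jM (T (p.1, εc * (p.2 : ℝ)))) = _
  exact hjT p.1 _ (mul_nonneg hεc.le p.2.2.1) (by nlinarith [p.2.2.2])


/-! ### The reduction -/

set_option maxHeartbeats 1600000 in
/-- **Reduction of Bär–Hanke's Thm. 27 (umbilic `C`-normal form, point family, end point) to
the deformation of the boundary cylinder.** If Props. 23 + 26 hold for Riemannian generalized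
cylinder metrics in the form `hcore` (see the module docstring: `C`-normalisation with
prescribed umbilic second fundamental form `μ G_0`, keeping `scal > 0` on `N × [0, ρ]` and the
metric beyond `t = ρ₁`), then `BarHanke2023_thm27_umbilicNormalForm` holds: embed `X` in its
double, take the boundary cylinder `G` of `g` (`exists_boundaryCylinderMetric`), deform it by
`hcore` (the hypothesis `(m+1)μ ≤ H_g` is `H^G_0 + (m+1)μ ≤ 0` by
`boundaryCylinder_sliceZero_meanCurvature`, and `scal_G > 0` on the tube by naturality), pull
the deformed cylinder back to the tube and patch with `g` (`exists_deformedMetric`), and read off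
the warped product in the geodesic collar of scale `εc ≤ ρ₀/2` (`exists_collar_of_fermiData`,
`collar_pullback_eq`, `boundaryCylinder_sliceZero_val`).
[cite: BarHanke2023, §3, Thm. 27 with Def. 21, Remark 22, Props. 23 and 26] -/
theorem BarHanke2023_thm27_umbilicNormalForm_of_cylinderDeformation
    (hcore : ∀ (m : ℕ) (N : Type) [TopologicalSpace N] [T2Space N] [CompactSpace N] [Nonempty N]
      [ChartedSpace (EuclideanSpace ℝ (Fin (m + 1))) N] [IsManifold (𝓡 (m + 1)) ∞ N]
      (G : PseudoRiemannianMetric ((𝓡 (m + 1)).prod 𝓘(ℝ, ℝ)) ∞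
        (EuclideanSpace ℝ (Fin (m + 1)) × ℝ)
        (TangentSpace ((𝓡 (m + 1)).prod 𝓘(ℝ, ℝ)) : N × ℝ → Type _)) [G.HasLeviCivita]
      (hG : G.IsRiemannian)
      (_hcyl : ∀ (p : N × ℝ) (v w : TangentSpace ((𝓡 (m + 1)).prod 𝓘(ℝ, ℝ)) p),
        G.val p v w = G.val p ((v.1, 0) : TangentSpace ((𝓡 (m + 1)).prod 𝓘(ℝ, ℝ)) p)
          ((w.1, 0) : TangentSpace ((𝓡 (m + 1)).prod 𝓘(ℝ, ℝ)) p) + v.2 * w.2)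
      (ε : ℝ) (_hε : 0 < ε)
      (_hpsc : ∀ (z : N), ∀ t ∈ Icc (0 : ℝ) ε, 0 < G.scalarCurvature (z, t))
      (μ : N → ℝ) (_hμ : ContMDiff (𝓡 (m + 1)) 𝓘(ℝ, ℝ) ∞ μ)
      (_hμH : ∀ z : N, G.meanCurvature (fun y : N ↦ ((y, (0 : ℝ)) : N × ℝ))
          (contMDiff_pullbackBilin_holds (I := (𝓡 (m + 1)).prod 𝓘(ℝ, ℝ)) (M := N × ℝ)
            (I' := 𝓡 (m + 1)) (N := N))
          (isSpacelikeImmersion_cylSlice G hG 0)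
          (fun y ↦ velocity ((𝓡 (m + 1)).prod 𝓘(ℝ, ℝ)) (fun s : ℝ ↦ ((y, s) : N × ℝ)) 0) z +
        (m + 1 : ℝ) * μ z ≤ 0),
      ∃ C₀ : ℝ, 0 < C₀ ∧ ∀ C : ℝ, C₀ ≤ C →
        ∃ (G' : PseudoRiemannianMetric ((𝓡 (m + 1)).prod 𝓘(ℝ, ℝ)) ∞
            (EuclideanSpace ℝ (Fin (m + 1)) × ℝ)
            (TangentSpace ((𝓡 (m + 1)).prod 𝓘(ℝ, ℝ)) : N × ℝ → Type _)) (_ : G'.HasLeviCivita)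
          (ρ₀ ρ₁ ρ : ℝ),
          G'.IsRiemannian ∧
          (∀ (p : N × ℝ) (v w : TangentSpace ((𝓡 (m + 1)).prod 𝓘(ℝ, ℝ)) p),
            G'.val p v w = G'.val p ((v.1, 0) : TangentSpace ((𝓡 (m + 1)).prod 𝓘(ℝ, ℝ)) p)
              ((w.1, 0) : TangentSpace ((𝓡 (m + 1)).prod 𝓘(ℝ, ℝ)) p) + v.2 * w.2) ∧
          0 < ρ₀ ∧ ρ₀ ≤ ρ ∧ 0 < ρ₁ ∧ ρ₁ < ρ ∧ ρ < ε ∧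
          (∀ (z : N) (t : ℝ), ρ₁ < t → G'.val (z, t) = G.val (z, t)) ∧
          (∀ (z : N), ∀ t ∈ Icc (0 : ℝ) ρ, 0 < G'.scalarCurvature (z, t)) ∧
          (∀ (z : N), ∀ t ∈ Icc (0 : ℝ) ρ₀, ∀ v w : EuclideanSpace ℝ (Fin (m + 1)),
            G'.val (z, t) ((v, 0) : TangentSpace ((𝓡 (m + 1)).prod 𝓘(ℝ, ℝ)) (z, t))
                ((w, 0) : TangentSpace ((𝓡 (m + 1)).prod 𝓘(ℝ, ℝ)) (z, t)) =
              (1 - 2 * μ z * t - C * t ^ 2) *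
                G.val (z, (0 : ℝ)) ((v, 0) : TangentSpace ((𝓡 (m + 1)).prod 𝓘(ℝ, ℝ)) (z, (0 : ℝ)))
                  ((w, 0) : TangentSpace ((𝓡 (m + 1)).prod 𝓘(ℝ, ℝ)) (z, (0 : ℝ))))) :
    BarHanke2023_thm27_umbilicNormalForm := by
  intro m X _ _ _ _ _ _ bX g _ hf ν μ hgR hpsc hunit hνs hout hμs hμH
  haveI : Fact (1 ≤ (∞ : ℕ∞ω)) := ⟨by exact_mod_cast le_top⟩
  -- empty boundary: nothing to do
  rcases isEmpty_or_nonempty bX.carrier with hemp | hne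
  · exact ⟨1, one_pos, fun C _ ↦ ⟨g, ‹g.HasLeviCivita›, 1, hgR, hpsc, fun z ↦ rfl, one_pos,
      fun ε _ _ ↦ ⟨bX.collarOfIsEmpty, fun p ↦ isEmptyElim p.1⟩⟩⟩
  haveI : Nonempty X := ⟨bX.incl (Classical.arbitrary _)⟩
  -- the double `P = X ∪_{id} X` and the piece embedding `jM`
  obtain ⟨P, _, _, _, _, _, _, hglue⟩ :=
    exists_isBoundaryGluing_holds (bM := bX) (bN := bX) (Diffeomorph.refl (𝓡 (m + 1)) bX.carrier ∞)
  obtain ⟨jM, jN, hjM, -, -, -⟩ := hglue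
  -- the boundary cylinder of `(X, g)`
  obtain ⟨gP, hLCP, hgPR, hpull, -, ε, hε, hdom, hplus, hminus, hTreg,
    ⟨ψ, hsrc, htgt, hsymm, hleft, hψs, hψsymms, hseam⟩, G, hGLC, hGR, hGcyl, hGval, hGscal⟩ :=
    exists_boundaryCylinderMetric bX hjM g hgR ν hunit hνs hout
  haveI := hLCP
  haveI := hGLC
  set T : bX.carrier × ℝ → P := fun q ↦ expMap gP.leviCivita (jM (bX.incl q.1))
    (q.2 • mfderiv (𝓡∂ (m + 2)) (𝓡 (m + 2)) jM (bX.incl q.1) (-ν q.1)) with hT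
  have hTs : ∀ q : bX.carrier × ℝ, q.2 ∈ Ioo (-ε) ε →
      ContMDiffAt ((𝓡 (m + 1)).prod 𝓘(ℝ, ℝ)) (𝓡 (m + 2)) ∞ T q := fun q hq ↦ (hTreg q hq).1
  have hTinj : ∀ q : bX.carrier × ℝ, q.2 ∈ Ioo (-ε) ε →
      Injective (mfderiv ((𝓡 (m + 1)).prod 𝓘(ℝ, ℝ)) (𝓡 (m + 2)) T q) := fun q hq ↦ (hTreg q hq).2
  haveI h1cov : CovariantDerivative.ContMDiffCovariantDerivative gP.leviCivita 1 :=
    contMDiffCovariantDerivative_leviCivita_of_two_le gP (WithTop.coe_le_coe.2 le_top)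
  haveI : T2Space bX.carrier := bX.isSmoothEmbedding.isEmbedding.t2Space
  haveI : CompactSpace bX.carrier := bX.compactSpace_carrier
  have hT0 : ∀ z, T (z, 0) = jM (bX.incl z) := fun z ↦ by
    show expMap gP.leviCivita (jM (bX.incl z))
      ((0 : ℝ) • mfderiv (𝓡∂ (m + 2)) (𝓡 (m + 2)) jM (bX.incl z) (-ν z)) = _
    rw [zero_smul]
    exact expMap_zero (cov := gP.leviCivita) _
  have hplus' : ∀ (z : bX.carrier), ∀ t ∈ Ioo 0 ε, T (z, t) ∈ range jM := fun z t ht ↦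
    image_subset_range _ _ (hplus z t ht)
  -- the slice data at `t = 0`
  have hG0 : ∀ (z : bX.carrier) (v w : EuclideanSpace ℝ (Fin (m + 1))),
      G.val (z, (0 : ℝ)) ((v, 0) : TangentSpace ((𝓡 (m + 1)).prod 𝓘(ℝ, ℝ)) (z, (0 : ℝ)))
        ((w, 0) : TangentSpace ((𝓡 (m + 1)).prod 𝓘(ℝ, ℝ)) (z, (0 : ℝ))) =
      g.val (bX.incl z) (mfderiv (𝓡 (m + 1)) (𝓡∂ (m + 2)) bX.incl z v)
        (mfderiv (𝓡 (m + 1)) (𝓡∂ (m + 2)) bX.incl z w) := fun z v w ↦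
    boundaryCylinder_sliceZero_val bX hjM g ν hνs gP hpull G hε hGval z v w
  have hH0 := boundaryCylinder_sliceZero_meanCurvature bX hjM g hf ν hνs gP hpull G hGR hε hTs
    hTinj hGval
  -- naturality of the scalar curvature along `jM` (all points, boundary included)
  have hvalg : ∀ q ∈ (univ : Set X), g.val q =
      pullbackBilin (I := 𝓡 (m + 2)) (I' := 𝓡∂ (m + 2)) jM gP.val q := fun q _ ↦
    ContinuousLinearMap.ext fun v ↦ ContinuousLinearMap.ext fun w ↦
      (by rw [pullbackBilin_apply, hpull])
  have hscalg : ∀ a : X, gP.scalarCurvature (jM a) = g.scalarCurvature a := fun a ↦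
    (scalarCurvature_eq_of_val_eq_pullbackBilin gP g isOpen_univ (fun q _ ↦ hjM.contMDiff q)
      (fun q _ ↦ injective_mfderiv_of_isImmersionAt' (hjM.isImmersion.isImmersionAt q)) rfl
      hvalg (q := a) (mem_univ a)).symm
  -- `scal_G > 0` on `∂X × [0, ε/2]`
  have hGpsc : ∀ (z : bX.carrier), ∀ t ∈ Icc (0 : ℝ) (ε / 2), 0 < G.scalarCurvature (z, t) := by
    intro z t ht
    have htε : t ∈ Ioo (-ε) ε := ⟨by linarith [ht.1], by linarith [ht.2]⟩
    rw [hGscal z t htε]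
    obtain ⟨a, ha⟩ : T (z, t) ∈ range jM := by
      rcases ht.1.eq_or_lt with h | h
      · rw [← h, hT0]
        exact mem_range_self _
      · exact hplus' z t ⟨h, htε.2⟩
    show 0 < gP.scalarCurvature (T (z, t))
    rw [← ha, hscalg a]
    exact hpsc a
  -- the analytic core on the boundary cylinder
  have hμH' : ∀ z : bX.carrier, G.meanCurvature (fun y : bX.carrier ↦ ((y, (0 : ℝ)) : bX.carrier × ℝ))
      (contMDiff_pullbackBilin_holds (I := (𝓡 (m + 1)).prod 𝓘(ℝ, ℝ)) (M := bX.carrier × ℝ)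
        (I' := 𝓡 (m + 1)) (N := bX.carrier))
      (isSpacelikeImmersion_cylSlice G hGR 0)
      (fun y ↦ velocity ((𝓡 (m + 1)).prod 𝓘(ℝ, ℝ)) (fun s : ℝ ↦ ((y, s) : bX.carrier × ℝ)) 0) z +
      (m + 1 : ℝ) * μ z ≤ 0 := by
    intro z
    rw [hH0 z]
    linarith [hμH z]
  obtain ⟨C₀, hC₀, hcoreC⟩ := hcore m bX.carrier G hGR hGcyl (ε / 2) (half_pos hε) hGpsc μ hμs hμH'
  refine ⟨C₀, hC₀, fun C hC ↦ ?_⟩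
  obtain ⟨G', hG'LC, ρ₀, ρ₁, ρ, hG'R, hG'cyl, hρ₀, hρ₀ρ, hρ₁, hρ₁ρ, hρε2, hG'G, hG'psc, hG'form⟩ :=
    hcoreC C hC
  haveI := hG'LC
  have hρε : ρ < ε := by linarith
  have hG'0 : ∀ (z : bX.carrier) (v w : EuclideanSpace ℝ (Fin (m + 1))),
      G'.val (z, (0 : ℝ)) ((v, 0) : TangentSpace ((𝓡 (m + 1)).prod 𝓘(ℝ, ℝ)) (z, (0 : ℝ)))
        ((w, 0) : TangentSpace ((𝓡 (m + 1)).prod 𝓘(ℝ, ℝ)) (z, (0 : ℝ))) =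
      G.val (z, (0 : ℝ)) ((v, 0) : TangentSpace ((𝓡 (m + 1)).prod 𝓘(ℝ, ℝ)) (z, (0 : ℝ)))
        ((w, 0) : TangentSpace ((𝓡 (m + 1)).prod 𝓘(ℝ, ℝ)) (z, (0 : ℝ))) := fun z v w ↦ by
    have h := hG'form z 0 ⟨le_rfl, hρ₀.le⟩ v w
    simpa using h
  -- the deformed metric on `X`
  obtain ⟨ĝ, hĝLC, hĝR, hĝpsc, hĝbdry, hĝU⟩ := exists_deformedMetric hjM g hgR hpsc gP hpull T ψ hε
    hTs hsrc htgt hsymm hleft hψs hT0 hminus G G' hGval hG0 hG'R hρ₁ hρ₁ρ hρε hG'G hG'psc hG'0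
  haveI := hĝLC
  refine ⟨ĝ, hĝLC, ρ₀ / 2, hĝR, hĝpsc, hĝbdry, half_pos hρ₀, fun εc hεc hεc0 ↦ ?_⟩
  -- the geodesic collar of scale `εc`
  have h2εc : 2 * εc < ε := by linarith
  have hεcρ : εc < ρ := by linarith
  obtain ⟨c, hc⟩ := exists_collar_of_fermiData hjM T ψ hTs hsrc htgt hsymm hleft hψs hT0 hplus'
    hminus hεc h2εc
  refine ⟨c, fun p V W ↦ ?_⟩
  have ht : εc * (p.2 : ℝ) ∈ Icc (0 : ℝ) ρ₀ :=
    ⟨mul_nonneg hεc.le p.2.2.1, by nlinarith [p.2.2.2]⟩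
  rw [collar_pullback_eq hjM ĝ T ψ hsrc hleft hψs G' hG'cyl hρε hĝU hεc hεcρ c (fun q ↦ (hc q).2)
    p V W, hG'form p.1 _ ht V.1 W.1, hG0 p.1 V.1 W.1, pullbackBilin_apply]


/-- **Bär–Hanke 2023, Thm. 27 (case `K = pt`, `σ = 0`, umbilic `k = μ g₀`), discharged**: the
named fact `BarHanke2023_thm27_umbilicNormalForm` holds. The reduction
`BarHanke2023_thm27_umbilicNormalForm_of_cylinderDeformation` (this file) is fed with the
cylinder deformation `cylinderDeformation_core` (`BaerHankeNormalFormCore.lean`: Bär–Hanke's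
Props. 23 and 26 assembled from the logarithmic cutoff, Lemma 25, formula (9) and the pointwise
estimates `MetricCoord.stepA_pointwise` / `MetricCoord.stepB_pointwise`).
[cite: BarHanke2023, §3, Thm. 27 with Def. 21, Remark 22, Props. 23, 26, Lemmas 24, 25] -/
theorem BarHanke2023_thm27_umbilicNormalForm_holds : BarHanke2023_thm27_umbilicNormalForm :=
  BarHanke2023_thm27_umbilicNormalForm_of_cylinderDeformation cylinderDeformation_core

end Literature.Geometry.Riemannian

end
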